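import Literature.MathematicalPhysics.QuantumFieldTheory.BalabanImbrieJaffe1984to88.BIJ88DexpCondMeanMajorant305
import Literature.MathematicalPhysics.QuantumFieldTheory.BalabanImbrieJaffe1984to88.BIJ88ActInFarCube309

/-!
# `BalabanImbrieJaffe1984to88.BIJ88EndChainFluct309` — T. Bałaban, J. Imbrie, A. Jaffe, *Effective action and cluster properties of the abelian
Higgs model*, Commun. Math. Phys. **114** (1988) 257–315 [BalabanImbrieJaffe1988], Sect. 5.13 p. 305–307 [PDF 49–51] with Sect. 5.14 (5.14.4)
p. 309 [PDF 53] and [Balaban1982Higgs2] (2.28)–(2.29) p. 563: **ON A THREE-CUBE CHAIN `□_a – □_b – □_n` THE CONDITIONAL-MEAN FLUCTUATION OF THE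
FAR CUBE'S PULLED-DOWN FACTOR IS SECOND ORDER IN THE DECAY LETTER** — the derivation, INSIDE the tree, of the row-sum form of the decay input
consumed by the smoothness-free engine (`BIJ88DexpCondMeanMajorant305.expect_abs_Dfun_cm_sub_le`: rows `Σ_k|T_{xk}|` of print's (2.29) boundary
operator `T = A_Λ⁻¹A_{ΛΛᶜ}`, `A = Δ_s`, `Λ` = the sites off the decorated cube `□_a`) from PRIMITIVE letters (owner r16 ⟦v2.271⟧): the pointwise
decay letter **(b)** `|(A_Λ)⁻¹(x,l)| ≤ c₁δ^{d(x,l)}` for the RESTRICTED inverse (print p. 307: *"chains of covariances C_ω(α) … If the walk ω(α) wanders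
through more than a few cubes, we begin to pickup factors e^{−cr(e_k)}"*; `δ` is print's `e^{−cr(e_k)}`, `d(x,l)` the separation of the sites in units
of the cube side `r(e_k)`), the geometry letters **W** (sites per cube) and **R** (off-diagonal row sums of `Δ`), and the one geometric fact of the
chain (the `□_n`-side of the middle cube and everything beyond it lie at least one unit from its `□_a`-side: print's cubes have side `r(e_k)`):

  `Σ_k |T_{xk}| ≤ W·c₁δ·R`  for `x ∈ □_n` or `x` on the `□_n`-side of `□_b`      (`rowSum_boundary_le`),
  `⟨|D_n∘cm − D_n(cm₀)|⟩_s ≤ W·R·(W c₁δR)²/m`  for `s ∈ [0,1]^I` supported in `{a,b,n}`, sourceless class `ℱ = 0`      (`fluct_le`),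

`m` the lower form bound of `Δ` (inherited by `Δ_{1_{Λ′}}` and `Δ_s`, p. 305), `D_n` the factor pulled down by `∂/∂s_n`, `cm` the conditional mean
given the `□_a`-fields ([Balaban1982Higgs2] (2.28)).  DIVERGENCE OF METHOD (declared): print obtains the per-cube smallness by `s`-derivatives
producing functional derivatives and random-walk expansions of `C_s` acting on `C²` observables; here the observable is only bounded and measurable
(the modulus slot fields of this lineage are not `C²`), the `s_n`-derivative is conditioned on the observable's cube instead, and the decay enters
through the restricted covariance `(A_Λ)⁻¹ = C^{(0)}_Λ` of (2.29) — the same covariance chains, with the walk replaced by conditioning.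

statement-level skeleton of published theorems with citation tags; proofs where landed; nothing here is a claim about the Yang–Mills mass gap

PDF held: `paper:balaban1988-cmp114-bij-abelian-higgs-effective-action` (journal page = PDF page + 256); p. 307 (p0051) as quoted; p. 305 (p0049 L24
*"the first derivative produces a term"*).

WHAT IS PROVED (unit `lit-balaban-p36`, generation 19 of the Phase-2 proof seat p36; SKELETON rows C2.Eq5.14.3-5.14.4 / C2.Eq5.13.3-5.13.4 of
`HOME/lit-balaban-r16/ROWS-C2-part2.md`, owner r16; 0 definitions, 0 `Prop` facts, theorems only).
* §0 `exists_quadForm_le` (every form on a finite lattice has an upper bound — the engine's `Cu`), `abs_interpForm_apply_le`, `interpForm_apply_eq_zero`.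
* §1 **`rowSum_boundary_le`** — (a) from (b)+W+R on the chain.
* §2 **`fluct_le`** — the display, via `expect_abs_Dfun_cm_sub_le` and `BIJ88ExpectTilt305.inv_apply_self_le` (`(Δ_s⁻¹)_{kk} ≤ 1/m`).
HONEST SCOPE: the sourceless class `ℱ = 0` (the data class of the kernel witness `BIJ88Ineq5144TripleDecayWitness`); with a source the drift terms
of the majorant enter at first order in `δ` and need a mean-field letter — not displayed here.  Imports `BIJ88DexpCondMeanMajorant305`,
`BIJ88ActInFarCube309` (p36 g19); modifies nothing.  NOT summit progress; NOT continuum; NOT Clay.  Cell `lit-balaban` Phase 2, seat p36 gen 19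
(owner r16, referee ref-5).
-/

noncomputable section

open Finset MeasureTheory Matrix Function Filter
open Literature.MathematicalPhysics.QuantumFieldTheory.Balaban1983to89
open Literature.MathematicalPhysics.QuantumFieldTheory.BalabanImbrieJaffe1984to88
open B2Eq228Conditioning (In Out resIn resOut glue blkIn blkMix condShift)
open BIJ88DirichletForms305 (interpForm interpForm_apply interpForm_posDef quadForm_interpForm_ge)
open BIJ88PolymerRep5134 (corner)
open BIJ88PolymerRep5134GaussWitness (corner_mem_cube)
open BIJ88SecondOrder5133 (num Dfun)
open BIJ88ExpectTilt305 (inv_apply_self_le)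
open BIJ88DexpCondMeanMajorant305 (expect_abs_Dfun_cm_sub_le)
open BIJ88ActInFarCube309 (interpForm_far)

namespace Literature.MathematicalPhysics.QuantumFieldTheory.BalabanImbrieJaffe1984to88.BIJ88EndChainFluct309

variable {α I : Type} [Fintype α] [DecidableEq α] [Fintype I] [DecidableEq I] (blk : α → I) (Δ : Matrix α α ℝ)

/-! ## §0 Elementary facts on forms and interpolated entries -/

omit [DecidableEq α] in
/-- every quadratic form on a finite lattice is bounded above by `(Σ_{xy}|M_{xy}|)·‖v‖²` (the engine's upper form bound `Cu`). [folklore]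
[cite: BalabanImbrieJaffe1988, §5.13 p.305] -/
theorem exists_quadForm_le (M : Matrix α α ℝ) : ∃ C : ℝ, ∀ v : α → ℝ, v ⬝ᵥ (M *ᵥ v) ≤ C * (v ⬝ᵥ v) := by
  refine ⟨∑ x, ∑ y, |M x y|, fun v => ?_⟩
  have hsq : ∀ x, v x ^ 2 ≤ v ⬝ᵥ v := fun x => by
    rw [dotProduct, sq]; exact Finset.single_le_sum (fun y _ => mul_self_nonneg (v y)) (Finset.mem_univ x)
  have hxy : ∀ x y, |v x * v y| ≤ v ⬝ᵥ v := fun x y => by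
    rw [abs_le]; constructor <;> nlinarith [hsq x, hsq y, sq_nonneg (v x - v y), sq_nonneg (v x + v y)]
  calc v ⬝ᵥ (M *ᵥ v) = ∑ x, ∑ y, M x y * (v x * v y) := by
        simp only [dotProduct, mulVec, Finset.mul_sum]
        exact Finset.sum_congr rfl fun x _ => Finset.sum_congr rfl fun y _ => by ring
    _ ≤ ∑ x, ∑ y, |M x y| * (v ⬝ᵥ v) := Finset.sum_le_sum fun x _ => Finset.sum_le_sum fun y _ =>
        (le_abs_self _).trans (by rw [abs_mul]; exact mul_le_mul_of_nonneg_left (hxy x y) (abs_nonneg _))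
    _ = (∑ x, ∑ y, |M x y|) * (v ⬝ᵥ v) := by
        rw [Finset.sum_mul]; exact Finset.sum_congr rfl fun x _ => by rw [Finset.sum_mul]

/-- `|(Δ_s)_{xy}| ≤ |Δ_{xy}|` for `s ∈ [0,1]^I` (the inter-cube entries are scaled by `s_is_{i′} ∈ [0,1]`). [cite: BalabanImbrieJaffe1988, §5.13 p.305] -/
theorem abs_interpForm_apply_le {s : I → ℝ} (hs : ∀ l, 0 ≤ s l ∧ s l ≤ 1) (x y : α) : |interpForm blk Δ s x y| ≤ |Δ x y| := by
  rw [interpForm_apply]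
  split_ifs with h
  · exact le_rfl
  · rw [abs_mul, abs_mul, abs_of_nonneg (hs _).1, abs_of_nonneg (hs _).1]
    exact mul_le_of_le_one_left (abs_nonneg _) (mul_le_one₀ (hs _).2 (hs _).1 (hs _).2)

/-- where `Δ` does not couple, neither does `Δ_s`. [cite: BalabanImbrieJaffe1988, §5.13 p.305] -/
theorem interpForm_apply_eq_zero (s : I → ℝ) {x y : α} (h : Δ x y = 0) : interpForm blk Δ s x y = 0 := by
  simp only [interpForm_apply, h, mul_zero, ite_self]

/-! ## §1 The rows of the boundary operator from the decay letter: (a) from (b) + W + R on the chain -/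

section RowSum

variable {Δ}

/-- **`Σ_k |T_{xk}| ≤ W·c₁δ·R` on the chain** for `T = A_Λ⁻¹A_{ΛΛᶜ}`, `A = (Δ_{1_{Λ′}})_s`, `Λ = {x | □x ≠ a}`, `s ∈ [0,1]^I` supported in `{a, b, n}`,
and `x ∈ □_n` or `x` a site of `□_b` coupled to `□_n`: only the sites `l ∈ □_b` coupled to `□_a` carry a nonzero row of `A_{ΛΛᶜ}` (`□_n` is not
coupled to `□_a`, the other cubes have `s = 0`), each such row sums to `≤ R`, there are `≤ W` of them, and for them the decay letter gives
`|(A_Λ)⁻¹(x,l)| ≤ c₁δ^{d(x,l)} ≤ c₁δ` (`d(x,l) ≥ 1`: the chain's geometry). [cite: BalabanImbrieJaffe1988, §5.13 p.307; (5.14.4) p.309] -/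
theorem rowSum_boundary_le {a b n : I} (hab : a ≠ b) (hfar : ∀ x y, blk x = n → blk y = a → Δ x y = 0)
    {W : ℕ} (hW : ∀ i, (univ.filter fun x : α => blk x = i).card ≤ W)
    {R : ℝ} (hR : ∀ x, ∑ y ∈ univ.filter (fun y => blk y ≠ blk x), |Δ x y| ≤ R)
    (ds : α → α → ℕ) {c₁ δ : ℝ} (hc₁ : 0 ≤ c₁) (hδ0 : 0 ≤ δ) (hδ1 : δ ≤ 1)
    (hgeo : ∀ x l, (blk x = n ∨ (blk x = b ∧ ∃ y, blk y = n ∧ Δ y x ≠ 0)) → blk l = b → (∃ k, blk k = a ∧ Δ l k ≠ 0) → 1 ≤ ds x l)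
    (Λc : Finset I) {s : I → ℝ} (hs : ∀ l, 0 ≤ s l ∧ s l ≤ 1) (hs0 : ∀ l, l ∉ ({a, b, n} : Finset I) → s l = 0)
    (hdec : ∀ x l : In (fun x => blk x ≠ a),
      |(blkIn (fun x => blk x ≠ a) (interpForm blk (interpForm blk Δ (corner ℝ Λc)) s))⁻¹ x l| ≤ c₁ * δ ^ ds x.1 l.1)
    (x : In (fun x => blk x ≠ a)) (hx : blk x.1 = n ∨ (blk x.1 = b ∧ ∃ y, blk y = n ∧ Δ y x.1 ≠ 0)) :
    ∑ k : Out (fun x => blk x ≠ a), |((blkIn (fun x => blk x ≠ a) (interpForm blk (interpForm blk Δ (corner ℝ Λc)) s))⁻¹ *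
        blkMix (fun x => blk x ≠ a) (interpForm blk (interpForm blk Δ (corner ℝ Λc)) s)) x k| ≤ W * (c₁ * δ * R) := by
  have hR0 : 0 ≤ R := le_trans (sum_nonneg fun _ _ => abs_nonneg _) (hR x.1)
  have hk : ∀ k : Out (fun x => blk x ≠ a), blk k.1 = a := fun k => not_ne_iff.1 k.2
  have hcs := corner_mem_cube (I := I) Λc
  -- the entries of `A_{ΛΛᶜ}`: `A(l,k) = s_{□l} s_a (Δ_{1_{Λ′}})_{lk}`
  have hAlk : ∀ (l : In (fun x => blk x ≠ a)) (k : Out (fun x => blk x ≠ a)),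
      interpForm blk (interpForm blk Δ (corner ℝ Λc)) s l.1 k.1 = s (blk l.1) * s a * interpForm blk Δ (corner ℝ Λc) l.1 k.1 := by
    intro l k
    rw [interpForm_apply, if_neg (by rw [hk k]; exact l.2), hk k]
  have hAabs : ∀ (l : In (fun x => blk x ≠ a)) (k : Out (fun x => blk x ≠ a)),
      |interpForm blk (interpForm blk Δ (corner ℝ Λc)) s l.1 k.1| ≤ |Δ l.1 k.1| := fun l k => by
    rw [hAlk, abs_mul, abs_mul, abs_of_nonneg (hs _).1, abs_of_nonneg (hs _).1]
    exact (mul_le_of_le_one_left (abs_nonneg _) (mul_le_one₀ (hs _).2 (hs _).1 (hs _).2)).trans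
      (abs_interpForm_apply_le blk Δ hcs _ _)
  -- the row of `A_{ΛΛᶜ}` at `l`: `≤ R` if `□l = b`, and `0` unless `l ∈ □_b` is coupled to `□_a`
  have hrowR : ∀ l : In (fun x => blk x ≠ a), blk l.1 = b →
      ∑ k : Out (fun x => blk x ≠ a), |interpForm blk (interpForm blk Δ (corner ℝ Λc)) s l.1 k.1| ≤ R := by
    intro l hlb
    have hmap : (univ : Finset (Out (fun x => blk x ≠ a))).map (Embedding.subtype _) ⊆ univ.filter (fun y => blk y ≠ blk l.1) := by
      intro y hy
      rw [Finset.mem_map] at hy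
      obtain ⟨k, -, rfl⟩ := hy
      refine mem_filter.2 ⟨mem_univ _, ?_⟩
      rw [Embedding.coe_subtype, hk k, hlb]
      exact hab
    calc ∑ k : Out (fun x => blk x ≠ a), |interpForm blk (interpForm blk Δ (corner ℝ Λc)) s l.1 k.1|
        ≤ ∑ k : Out (fun x => blk x ≠ a), |Δ l.1 k.1| := sum_le_sum fun k _ => hAabs l k
      _ = ∑ y ∈ (univ : Finset (Out (fun x => blk x ≠ a))).map (Embedding.subtype _), |Δ l.1 y| := by rw [sum_map]; rfl
      _ ≤ ∑ y ∈ univ.filter (fun y => blk y ≠ blk l.1), |Δ l.1 y| := sum_le_sum_of_subset_of_nonneg hmap fun _ _ _ => abs_nonneg _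
      _ ≤ R := hR l.1
  have hrow0 : ∀ l : In (fun x => blk x ≠ a), ¬ (blk l.1 = b ∧ ∃ k, blk k = a ∧ Δ l.1 k ≠ 0) →
      ∑ k : Out (fun x => blk x ≠ a), |interpForm blk (interpForm blk Δ (corner ℝ Λc)) s l.1 k.1| = 0 := by
    intro l hl
    refine sum_eq_zero fun k _ => ?_
    rw [abs_eq_zero, hAlk]
    by_cases hlb : blk l.1 = b
    · have h0 : Δ l.1 k.1 = 0 := by
        by_contra h
        exact hl ⟨hlb, k.1, hk k, h⟩
      rw [interpForm_apply_eq_zero blk Δ _ h0, mul_zero]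
    · rcases eq_or_ne (blk l.1) n with hln | hln
      · rw [interpForm_apply_eq_zero blk Δ _ (hfar _ _ hln (hk k)), mul_zero]
      · have hout : blk l.1 ∉ ({a, b, n} : Finset I) := by
          simp only [mem_insert, mem_singleton, not_or]; exact ⟨l.2, hlb, hln⟩
        rw [hs0 _ hout, zero_mul, zero_mul]
  -- each `l` contributes `≤ c₁δR` if `□l = b`, else nothing
  have hl : ∀ l : In (fun x => blk x ≠ a),
      |(blkIn (fun x => blk x ≠ a) (interpForm blk (interpForm blk Δ (corner ℝ Λc)) s))⁻¹ x l| *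
          ∑ k : Out (fun x => blk x ≠ a), |interpForm blk (interpForm blk Δ (corner ℝ Λc)) s l.1 k.1|
        ≤ if blk l.1 = b then c₁ * δ * R else 0 := by
    intro l
    by_cases hcpl : blk l.1 = b ∧ ∃ k, blk k = a ∧ Δ l.1 k ≠ 0
    · rw [if_pos hcpl.1]
      have h1 : |(blkIn (fun x => blk x ≠ a) (interpForm blk (interpForm blk Δ (corner ℝ Λc)) s))⁻¹ x l| ≤ c₁ * δ := by
        refine (hdec x l).trans (mul_le_mul_of_nonneg_left ?_ hc₁)
        calc δ ^ ds x.1 l.1 ≤ δ ^ 1 := pow_le_pow_of_le_one hδ0 hδ1 (hgeo x.1 l.1 hx hcpl.1 hcpl.2)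
          _ = δ := pow_one δ
      calc _ ≤ (c₁ * δ) * R := mul_le_mul h1 (hrowR l hcpl.1) (sum_nonneg fun _ _ => abs_nonneg _) (mul_nonneg hc₁ hδ0)
        _ = c₁ * δ * R := by ring
    · rw [hrow0 l hcpl, mul_zero]
      split_ifs
      · exact mul_nonneg (mul_nonneg hc₁ hδ0) hR0
      · exact le_rfl
  -- at most `W` sites in `□_b`
  have hcardW : (((univ : Finset (In (fun x => blk x ≠ a))).filter fun l => blk l.1 = b).card : ℝ) ≤ W := by
    have h : ((univ : Finset (In (fun x => blk x ≠ a))).filter fun l => blk l.1 = b).card ≤ (univ.filter fun y : α => blk y = b).card :=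
      card_le_card_of_injOn (fun l => l.1)
        (fun l hl => by
          simp only [coe_filter, mem_univ, true_and, Set.mem_setOf_eq] at hl ⊢
          exact hl)
        (fun l₁ _ l₂ _ h => Subtype.ext h)
    exact_mod_cast h.trans (hW b)
  calc ∑ k : Out (fun x => blk x ≠ a), |((blkIn (fun x => blk x ≠ a) (interpForm blk (interpForm blk Δ (corner ℝ Λc)) s))⁻¹ *
          blkMix (fun x => blk x ≠ a) (interpForm blk (interpForm blk Δ (corner ℝ Λc)) s)) x k|
      = ∑ k : Out (fun x => blk x ≠ a), |∑ l, (blkIn (fun x => blk x ≠ a) (interpForm blk (interpForm blk Δ (corner ℝ Λc)) s))⁻¹ x l *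
          interpForm blk (interpForm blk Δ (corner ℝ Λc)) s l.1 k.1| := by
        simp only [Matrix.mul_apply, blkMix, Matrix.submatrix_apply]
    _ ≤ ∑ k : Out (fun x => blk x ≠ a), ∑ l, |(blkIn (fun x => blk x ≠ a) (interpForm blk (interpForm blk Δ (corner ℝ Λc)) s))⁻¹ x l| *
          |interpForm blk (interpForm blk Δ (corner ℝ Λc)) s l.1 k.1| :=
        sum_le_sum fun k _ => (abs_sum_le_sum_abs _ _).trans (le_of_eq (sum_congr rfl fun l _ => abs_mul _ _))
    _ = ∑ l, |(blkIn (fun x => blk x ≠ a) (interpForm blk (interpForm blk Δ (corner ℝ Λc)) s))⁻¹ x l| *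
          ∑ k : Out (fun x => blk x ≠ a), |interpForm blk (interpForm blk Δ (corner ℝ Λc)) s l.1 k.1| := by
        rw [sum_comm]; simp only [mul_sum]
    _ ≤ ∑ l : In (fun x => blk x ≠ a), (if blk l.1 = b then c₁ * δ * R else 0) := sum_le_sum fun l _ => hl l
    _ = (((univ : Finset (In (fun x => blk x ≠ a))).filter fun l => blk l.1 = b).card : ℝ) * (c₁ * δ * R) := by
        rw [← sum_filter, sum_const, nsmul_eq_mul]
    _ ≤ W * (c₁ * δ * R) := mul_le_mul_of_nonneg_right hcardW (mul_nonneg (mul_nonneg hc₁ hδ0) hR0)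

end RowSum

/-! ## §2 The fluctuation of the far cube's pulled-down factor on the chain -/

section Fluct

variable {Δ}

omit [Fintype I] in
/-- **the bookkeeping of the majorant** (`BIJ88DexpCondMeanMajorant305.expect_abs_Dfun_cm_sub_le`, its right side verbatim): with vanishing
drift `d = 0`, second moments `≤ μ`, rows `Σ_k|T_{xk}| ≤ ρ` for `x ∈ □_n` and for the `x` satisfying `Q`, and coefficients vanishing off `Q`,
the majorant is `≤ (Σ_{x∈□_n, y} w_{xy})·ρ²μ`. [cite: BalabanImbrieJaffe1988, §5.13 p.307] -/
theorem majorant_le_of_rows (p : α → Prop) [DecidablePred p] (s : I → ℝ) (n : I) (A₀ A : Matrix α α ℝ) (T : Matrix (In p) (Out p) ℝ)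
    (d : In p → ℝ) (m : α → ℝ) (hd : d = 0) {μ : ℝ} (hμ : 0 ≤ μ) (hm : ∀ k : Out p, A⁻¹ k.1 k.1 + m k.1 ^ 2 ≤ μ)
    (hm0 : ∀ k : Out p, 0 ≤ A⁻¹ k.1 k.1 + m k.1 ^ 2) (Q : In p → Prop) {ρ : ℝ}
    (hrow : ∀ x : In p, (blk x.1 = n ∨ Q x) → ∑ k, |T x k| ≤ ρ) (w : In p → In p → ℝ) (hw0 : ∀ i j, 0 ≤ w i j)
    (hpref : ∀ i j : In p, blk i.1 = n → blk j.1 ≠ n → |s (blk j.1) * A₀ i.1 j.1| ≤ w i j)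
    (hzero : ∀ i j : In p, blk i.1 = n → blk j.1 ≠ n → ¬ Q j → s (blk j.1) * A₀ i.1 j.1 = 0) :
    ∑ i : In p, ∑ j : In p, |(if blk i = n ∧ blk j ≠ n then s (blk j) * A₀ i j else 0)| *
        ((1 / 2) * ((∑ k, |T i k|) * ∑ k, |T i k| * (A⁻¹ k k + m k ^ 2) + (∑ k, |T j k|) * ∑ k, |T j k| * (A⁻¹ k k + m k ^ 2))
          + |d i| * ∑ k, |T j k| * ((1 + (A⁻¹ k k + m k ^ 2)) / 2)
          + |d j| * ∑ k, |T i k| * ((1 + (A⁻¹ k k + m k ^ 2)) / 2))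
      ≤ ∑ i : In p, ∑ j : In p, (if blk i.1 = n ∧ blk j.1 ≠ n then w i j else 0) * (ρ ^ 2 * μ) := by
  subst hd
  refine sum_le_sum fun i _ => sum_le_sum fun j _ => ?_
  -- the weighted rows
  have hS : ∀ x : In p, (blk x.1 = n ∨ Q x) → (∑ k, |T x k|) * ∑ k, |T x k| * (A⁻¹ k.1 k.1 + m k.1 ^ 2) ≤ ρ ^ 2 * μ := by
    intro x hx
    have h0 : 0 ≤ ∑ k, |T x k| := sum_nonneg fun _ _ => abs_nonneg _
    have h1 : ∑ k, |T x k| * (A⁻¹ k.1 k.1 + m k.1 ^ 2) ≤ (∑ k, |T x k|) * μ := by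
      rw [sum_mul]; exact sum_le_sum fun k _ => mul_le_mul_of_nonneg_left (hm k) (abs_nonneg _)
    calc (∑ k, |T x k|) * ∑ k, |T x k| * (A⁻¹ k.1 k.1 + m k.1 ^ 2) ≤ (∑ k, |T x k|) * ((∑ k, |T x k|) * μ) :=
          mul_le_mul_of_nonneg_left h1 h0
      _ = (∑ k, |T x k|) ^ 2 * μ := by ring
      _ ≤ ρ ^ 2 * μ := mul_le_mul_of_nonneg_right (pow_le_pow_left₀ h0 (hrow x hx) 2) hμ
  have hS0 : ∀ x : In p, 0 ≤ (∑ k, |T x k|) * ∑ k, |T x k| * (A⁻¹ k.1 k.1 + m k.1 ^ 2) := fun x =>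
    mul_nonneg (sum_nonneg fun _ _ => abs_nonneg _) (sum_nonneg fun k _ => mul_nonneg (abs_nonneg _) (hm0 k))
  by_cases hc : blk i.1 = n ∧ blk j.1 ≠ n
  · rw [if_pos hc, if_pos hc]
    simp only [Pi.zero_apply, abs_zero, zero_mul, add_zero]
    by_cases hq : Q j
    · refine mul_le_mul (hpref i j hc.1 hc.2) ?_ (mul_nonneg (by norm_num) (add_nonneg (hS0 i) (hS0 j))) (hw0 i j)
      have hi := hS i (Or.inl hc.1)
      have hj := hS j (Or.inr hq)
      linarith
    · rw [hzero i j hc.1 hc.2 hq, abs_zero, zero_mul]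
      exact mul_nonneg (hw0 i j) (mul_nonneg (sq_nonneg _) hμ)
  · rw [if_neg hc, if_neg hc, abs_zero, zero_mul, zero_mul]

omit [DecidableEq α] [Fintype I] in
/-- the `|Δ|`-weight of the pairs `x ∈ □_n`, `y ∉ □_n` among the sites of `Λ` is `≤ W·R`. [cite: BalabanImbrieJaffe1988, §5.13 p.305] -/
theorem sum_sum_abs_le (p : α → Prop) [DecidablePred p] (n : I) {W : ℕ} (hW : ∀ i, (univ.filter fun x : α => blk x = i).card ≤ W)
    {R : ℝ} (hR0 : 0 ≤ R) (hR : ∀ x, ∑ y ∈ univ.filter (fun y => blk y ≠ blk x), |Δ x y| ≤ R) :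
    (∑ i : In p, ∑ j : In p, if blk i.1 = n ∧ blk j.1 ≠ n then |Δ i.1 j.1| else 0) ≤ W * R := by
  have hin : ∀ i : In p, (∑ j : In p, if blk i.1 = n ∧ blk j.1 ≠ n then |Δ i.1 j.1| else 0) ≤ if blk i.1 = n then R else 0 := by
    intro i
    by_cases hi : blk i.1 = n
    · simp only [hi, true_and, if_true]
      have hmap : ((univ : Finset (In p)).filter fun j => blk j.1 ≠ n).map (Embedding.subtype _) ⊆
          univ.filter (fun y => blk y ≠ blk i.1) := by
        intro y hy
        rw [Finset.mem_map] at hy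
        obtain ⟨j, hj, rfl⟩ := hy
        refine mem_filter.2 ⟨mem_univ _, ?_⟩
        rw [Embedding.coe_subtype, hi]
        exact (mem_filter.1 hj).2
      calc (∑ j : In p, if blk j.1 ≠ n then |Δ i.1 j.1| else 0)
          = ∑ y ∈ ((univ : Finset (In p)).filter fun j => blk j.1 ≠ n).map (Embedding.subtype _), |Δ i.1 y| := by
            rw [sum_map, sum_filter]; rfl
        _ ≤ ∑ y ∈ univ.filter (fun y => blk y ≠ blk i.1), |Δ i.1 y| := sum_le_sum_of_subset_of_nonneg hmap fun _ _ _ => abs_nonneg _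
        _ ≤ R := hR i.1
    · simp only [hi, false_and, if_false, sum_const_zero, le_refl]
  have hcardW : (((univ : Finset (In p)).filter fun i => blk i.1 = n).card : ℝ) ≤ W := by
    have h : ((univ : Finset (In p)).filter fun i => blk i.1 = n).card ≤ (univ.filter fun y : α => blk y = n).card :=
      card_le_card_of_injOn (fun i => i.1)
        (fun i hi => by
          simp only [coe_filter, mem_univ, true_and, Set.mem_setOf_eq] at hi ⊢
          exact hi)
        (fun i₁ _ i₂ _ h => Subtype.ext h)
    exact_mod_cast h.trans (hW n)
  calc (∑ i : In p, ∑ j : In p, if blk i.1 = n ∧ blk j.1 ≠ n then |Δ i.1 j.1| else 0)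
      ≤ ∑ i : In p, (if blk i.1 = n then R else 0) := sum_le_sum fun i _ => hin i
    _ = (((univ : Finset (In p)).filter fun i => blk i.1 = n).card : ℝ) * R := by rw [← sum_filter, sum_const, nsmul_eq_mul]
    _ ≤ W * R := mul_le_mul_of_nonneg_right hcardW hR0

/-- **`⟨|D_n∘cm − D_n(cm₀)|⟩_s ≤ W·R·(Wc₁δR)²/m` on the sourceless end-decorated chain** (`ℱ = 0`; `Δ ≻ 0`, `Δ ≥ m·1`; `□_n` not coupled to
`□_a`; W, R; the decay letter (b) at `s`; `s ∈ [0,1]^I` supported in `{a,b,n}`): in the majorant `expect_abs_Dfun_cm_sub_le` the drifts vanish,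
`(Δ_s⁻¹)_{kk} ≤ 1/m` (`inv_apply_self_le`), only the pairs `x ∈ □_n`, `y ∈ □_b` coupled to `□_n` occur (`≤ W·R` in `|Δ_{xy}|`-weight), and for them
both rows of `T` are `≤ Wc₁δR` (§1). [cite: BalabanImbrieJaffe1988, §5.13 p.307; (5.14.4) p.309] -/
theorem fluct_le (hΔ : Δ.PosDef) {m : ℝ} (hm : 0 < m) (hΔm : ∀ φ : α → ℝ, m * (φ ⬝ᵥ φ) ≤ φ ⬝ᵥ (Δ *ᵥ φ))
    {a b n : I} (hab : a ≠ b) (han : a ≠ n) (hfar : ∀ x y, blk x = n → blk y = a → Δ x y = 0)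
    {W : ℕ} (hW : ∀ i, (univ.filter fun x : α => blk x = i).card ≤ W)
    {R : ℝ} (hR0 : 0 ≤ R) (hR : ∀ x, ∑ y ∈ univ.filter (fun y => blk y ≠ blk x), |Δ x y| ≤ R)
    (ds : α → α → ℕ) {c₁ δ : ℝ} (hc₁ : 0 ≤ c₁) (hδ0 : 0 ≤ δ) (hδ1 : δ ≤ 1)
    (hgeo : ∀ x l, (blk x = n ∨ (blk x = b ∧ ∃ y, blk y = n ∧ Δ y x ≠ 0)) → blk l = b → (∃ k, blk k = a ∧ Δ l k ≠ 0) → 1 ≤ ds x l)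
    (Λc : Finset I) {s : I → ℝ} (hs : ∀ l, 0 ≤ s l ∧ s l ≤ 1) (hs0 : ∀ l, l ∉ ({a, b, n} : Finset I) → s l = 0)
    (hdec : ∀ x l : In (fun x => blk x ≠ a),
      |(blkIn (fun x => blk x ≠ a) (interpForm blk (interpForm blk Δ (corner ℝ Λc)) s))⁻¹ x l| ≤ c₁ * δ ^ ds x.1 l.1) :
    num blk (interpForm blk Δ (corner ℝ Λc)) 0 (fun φ => |Dfun blk (interpForm blk Δ (corner ℝ Λc)) s n
          (glue (fun x => blk x ≠ a) (condShift (fun x => blk x ≠ a) (interpForm blk (interpForm blk Δ (corner ℝ Λc)) s) 0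
            (resOut (fun x => blk x ≠ a) φ)) (resOut (fun x => blk x ≠ a) φ))
        - Dfun blk (interpForm blk Δ (corner ℝ Λc)) s n
          (glue (fun x => blk x ≠ a) ((blkIn (fun x => blk x ≠ a) (interpForm blk (interpForm blk Δ (corner ℝ Λc)) s))⁻¹ *ᵥ
            resIn (fun x => blk x ≠ a) 0) 0)|) s
        / num blk (interpForm blk Δ (corner ℝ Λc)) 0 (fun _ => 1) s
      ≤ W * R * ((W * (c₁ * δ * R)) ^ 2 * m⁻¹) := by
  have hcs := corner_mem_cube (I := I) Λc
  have hΔc : (interpForm blk Δ (corner ℝ Λc)).PosDef := interpForm_posDef blk hΔ hcs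
  have hmΔc : ∀ φ : α → ℝ, m * (φ ⬝ᵥ φ) ≤ φ ⬝ᵥ (interpForm blk Δ (corner ℝ Λc) *ᵥ φ) := quadForm_interpForm_ge blk hΔm hcs
  have hA : (interpForm blk (interpForm blk Δ (corner ℝ Λc)) s).PosDef := interpForm_posDef blk hΔc hs
  have hmA : ∀ v : α → ℝ, m * (v ⬝ᵥ v) ≤ v ⬝ᵥ (interpForm blk (interpForm blk Δ (corner ℝ Λc)) s *ᵥ v) :=
    quadForm_interpForm_ge blk hmΔc hs
  have hPn : ∀ x, blk x = n → (fun x => blk x ≠ a) x := fun x hx h => han (h.symm.trans hx)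
  have hfar' : ∀ x y, blk x = n → ¬ (fun x => blk x ≠ a) y → interpForm blk Δ (corner ℝ Λc) x y = 0 :=
    fun x y hx hy => interpForm_apply_eq_zero blk Δ _ (hfar x y hx (not_ne_iff.1 hy))
  have hmaj := expect_abs_Dfun_cm_sub_le blk hΔc (0 : α → ℝ) hs (fun x => blk x ≠ a) hPn hfar'
    (interpForm blk (interpForm blk Δ (corner ℝ Λc)) s) rfl
    ((blkIn (fun x => blk x ≠ a) (interpForm blk (interpForm blk Δ (corner ℝ Λc)) s))⁻¹ *
      blkMix (fun x => blk x ≠ a) (interpForm blk (interpForm blk Δ (corner ℝ Λc)) s)) rfl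
    ((blkIn (fun x => blk x ≠ a) (interpForm blk (interpForm blk Δ (corner ℝ Λc)) s))⁻¹ *ᵥ resIn (fun x => blk x ≠ a) 0) rfl
    ((interpForm blk (interpForm blk Δ (corner ℝ Λc)) s)⁻¹ *ᵥ 0) rfl
  refine hmaj.trans ?_
  have hd0 : (blkIn (fun x => blk x ≠ a) (interpForm blk (interpForm blk Δ (corner ℝ Λc)) s))⁻¹ *ᵥ
      resIn (fun x => blk x ≠ a) (0 : α → ℝ) = 0 := by
    rw [show resIn (fun x => blk x ≠ a) (0 : α → ℝ) = 0 from rfl, mulVec_zero]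
  have hm' : ∀ k : Out (fun x => blk x ≠ a), (interpForm blk (interpForm blk Δ (corner ℝ Λc)) s)⁻¹ k.1 k.1 +
      ((interpForm blk (interpForm blk Δ (corner ℝ Λc)) s)⁻¹ *ᵥ (0 : α → ℝ)) k.1 ^ 2 ≤ m⁻¹ := fun k => by
    rw [mulVec_zero, Pi.zero_apply, sq, mul_zero, add_zero]; exact inv_apply_self_le hA hm hmA k.1
  have hm0' : ∀ k : Out (fun x => blk x ≠ a), 0 ≤ (interpForm blk (interpForm blk Δ (corner ℝ Λc)) s)⁻¹ k.1 k.1 +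
      ((interpForm blk (interpForm blk Δ (corner ℝ Λc)) s)⁻¹ *ᵥ (0 : α → ℝ)) k.1 ^ 2 := fun k =>
    add_nonneg hA.inv.posSemidef.diag_nonneg (sq_nonneg _)
  have hC : 0 ≤ (W * (c₁ * δ * R)) ^ 2 * m⁻¹ := mul_nonneg (sq_nonneg _) (inv_nonneg.2 hm.le)
  refine (majorant_le_of_rows blk (fun x => blk x ≠ a) s n (interpForm blk Δ (corner ℝ Λc)) _ _ _ _ hd0 (inv_nonneg.2 hm.le)
    hm' hm0' (fun j => blk j.1 = b ∧ ∃ y, blk y = n ∧ Δ y j.1 ≠ 0)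
    (fun x hx => rowSum_boundary_le blk hab hfar hW hR ds hc₁ hδ0 hδ1 hgeo Λc hs hs0 hdec x hx)
    (fun i j => |Δ i.1 j.1|) (fun _ _ => abs_nonneg _) (fun i j _ _ => ?_) (fun i j hi hj hq => ?_)).trans ?_
  · -- the coefficients: `|s_{□y}(Δ_{1_{Λ′}})_{xy}| ≤ |Δ_{xy}|`
    rw [abs_mul, abs_of_nonneg (hs _).1]
    exact (mul_le_of_le_one_left (abs_nonneg _) (hs _).2).trans (abs_interpForm_apply_le blk Δ hcs _ _)
  · -- the coefficients vanish off the `□_n`-coupled sites of `□_b`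
    push Not at hq
    rcases eq_or_ne (blk j.1) b with hjb | hjb
    · rw [interpForm_apply_eq_zero blk Δ _ (hq hjb _ hi), mul_zero]
    · have hout : blk j.1 ∉ ({a, b, n} : Finset I) := by
        simp only [mem_insert, mem_singleton, not_or]; exact ⟨j.2, hjb, hj⟩
      rw [hs0 _ hout, zero_mul]
  · -- the `|Δ|`-weight of the pairs is `≤ W·R`
    have hsum := sum_sum_abs_le blk (fun x => blk x ≠ a) n hW hR0 hR
    calc ∑ i : In (fun x => blk x ≠ a), ∑ j : In (fun x => blk x ≠ a),
          (if blk i.1 = n ∧ blk j.1 ≠ n then |Δ i.1 j.1| else 0) * ((W * (c₁ * δ * R)) ^ 2 * m⁻¹)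
        = (∑ i : In (fun x => blk x ≠ a), ∑ j : In (fun x => blk x ≠ a),
            if blk i.1 = n ∧ blk j.1 ≠ n then |Δ i.1 j.1| else 0) * ((W * (c₁ * δ * R)) ^ 2 * m⁻¹) := by simp only [sum_mul]
      _ ≤ (W * R) * ((W * (c₁ * δ * R)) ^ 2 * m⁻¹) := mul_le_mul_of_nonneg_right hsum hC
      _ = W * R * ((W * (c₁ * δ * R)) ^ 2 * m⁻¹) := rfl

end Fluct

end Literature.MathematicalPhysics.QuantumFieldTheory.BalabanImbrieJaffe1984to88.BIJ88EndChainFluct309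

end
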